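import Mathlib
import HarnessLib
import Literature.Analysis.FluidPDE.TypeIAncientMildClassical
import Summits.NavierStokesRegularity.NavierStokesRegularity.Theorems.PoloidalWindowDoorPoloidalWindowRigidityClassSpaceTimeRates
import Summits.NavierStokesRegularity.NavierStokesRegularity.Theorems.PoloidalWindowDoorPoloidalWindowRigidityClassRate
import Summits.NavierStokesRegularity.NavierStokesRegularity.Theorems.PoloidalWindowDoorPoloidalWindowRigidityWindow
import Summits.NavierStokesRegularity.NavierStokesRegularity.Theorems.PoloidalWindowDoorPoloidalWindowRigiditySparseEnergyFarFlux

/-!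
# Route `PoloidalWindowDoor`, crux `PoloidalWindowRigidity` (stmt-19708), line `sparse_energy` (cstrat g11) —
# stub S1 `stub_scaledEnergy`, FIRST BRICK: the local energy identity of a class profile from `s = −∞` with MEAN-FREE FLUXES,
# and the FAR-FROM-THE-APEX half of S1 (`E(R,t₀) ≲ R²/√(−t₀) + R³/(−t₀)`, hence `≤ K·R` for `−t₀ ≥ R²`)

Seat ns-poloidal-K2-p2 g9 (successor of the interim LEAD-of-record on 19708; file `--supports`).  Line card
`Cruxes/PoloidalWindowRigidity/Lines/sparse_energy.md` §Idea / §Stubs (S1): «the local energy identity has no unsigned volume source,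
only fluxes through ∂B_R; started at s = −∞ (where the ball energy ≤ cC²R³/(−s) vanishes) … Far from the apex (−t₀ ≥ C²R²) this gives
E ≤ c(C²+C₁)R at once».  This file proves exactly that, for a profile `v` of the route's Type-I class (`‖v(t,x)‖ ≤ C/√(−t)`,
continuous on the slab, Oseen-mild, divergence-free), with the tree's tools only:

* the class is a classical Navier–Stokes solution on every window `(T,0)` with SOME smooth pressure `q`
  (`IsTypeIAncientMild.exists_isClassicalNSSolutionOn_Ioo`), and carries the scale-sharp rates `‖Dv(t)‖ ≤ C₁/(−t)`
  (`…ClassRate.exists_fderiv_rate_of_class`) and `‖∇q(t)‖ ≤ K_p/((−t)√(−t))` for EVERY such pressure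
  (`…ClassSpaceTimeRates.exists_pressureGradient_rate_of_class`);
* (sibling file `…SparseEnergyFarFlux`, `abs_flux_le`) with the cut-off `ψ = cutoff R (a − ·)` (`= 1` on `B̄(a,R)`, `= 0` off `B(a,2R)`,
  `|Δψ| ≤ C_Δ/R²`, `‖Dψ‖ ≤ C_∇/R`) the slice flux `F(t) = ∫ (Δψ|v|² + Dψ(v)|v|² + 2qDψ(v))` is MEAN-FREE in all three terms
  (`∫Δψ = 0`, `∫Dψ(v) = −∫ψ div v = 0`), so only OSCILLATIONS over `B̄(a,2R)` enter:
  `|F(t)| ≤ A₀·R²/((−t)√(−t)) + B₀·R³/t²` on the window, `A₀ = 32V₁C_ΔCC₁`, `B₀ = 32V₁C_∇C(CC₁ + K_p)`, `V₁ = |B(0,1)|`;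
* `cutoffEnergy_dissipation_le` — `…ClassicalLocalEnergyCutoff.local_energy_identity_cutoff` on `[s, t₀]` with the window pressure of
  `IsTypeIAncientMild.exists_isClassicalNSSolutionOn_Ioo` and `E_ψ(s) ≤ |B̄(a,2R)|·C²/(−s) ≤ 8V₁C²R³/(−t₀)`:
  `∫ ψ|v(t₀)|² ≤ A·R²/√(−t₀) + B·R³/(−t₀)` and `2∫_{s}^{t₀}∫ |Dv|²_F ψ ≤ A·R²/√(−t₀) + B·R³/(−t₀)` for all `s < t₀ < 0`, all `a`, `R > 0`
  (`A = 2A₀`, `B = B₀ + 8V₁C²`);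
* `ballEnergy_le` — the same for `∫_{B(a,R)} |v(t₀)|²` (Bochner and `∫⁻ … ENNReal.ofReal`);
* `ballEnergy_le_far`, `cutoffDissipation_le_far` — the FAR HALF OF S1: for `t₀ ≤ −R²`, `∫_{B(a,R)} |v(t₀)|² ≤ K·R` (Bochner and
  `∫⁻ … ENNReal.ofReal` forms, the latter = the first conjunct of S1's conclusion verbatim on `−t₀ ≥ R²`) and
  `2∫_{s}^{t₀}∫ |Dv|²_F ψ ≤ K·R` for every `s < t₀` (`|Dv|²_F ≥ ‖Dv‖²`, `ψ ≥ 𝟙_{B(a,R)}`).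

NOT here: the near-apex half of S1 (`−R² < t₀ < 0`): the card's bootstrap in `R` needs a pressure-modulo-constants (Riesz) representation
for the TIME-decay class (tree: only under `HasTypeIDecay`, `isClassicalNSSolutionOn_rieszPressure`).

WHAT THIS IS NOT: not a claim about Navier–Stokes regularity, not S1 — an a-priori estimate for the route's profile class far from the apex
(bears_on LADDER-NS N0 via crux 19708, line sparse_energy, stub S1). [folklore]
-/

noncomputable section

-- the summit and its single sub-problem share the name (CONVENTIONS §1), as in every Theorems file
set_option linter.dupNamespace false

namespace Summit.NavierStokesRegularity.NavierStokesRegularity.Theorems.PoloidalWindowDoorPoloidalWindowRigiditySparseEnergyFarField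

open MeasureTheory Set Function Filter Topology Metric InnerProductSpace
open scoped RealInnerProductSpace InnerProductSpace Laplacian ENNReal
open Literature.Analysis Literature.Analysis.FluidPDE
open Summit.NavierStokesRegularity.NavierStokesRegularity.Theorems.PoloidalWindowDoorPoloidalWindowRigidityClassSpaceTimeRates
open Summit.NavierStokesRegularity.NavierStokesRegularity.Theorems.PoloidalWindowDoorPoloidalWindowRigidityClassRate
open Summit.NavierStokesRegularity.NavierStokesRegularity.Theorems.PoloidalWindowDoorPoloidalWindowRigidityWindow
open Summit.NavierStokesRegularity.NavierStokesRegularity.Theorems.PoloidalWindowDoorPoloidalWindowRigidityEllipticSliceThinStrain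

variable {C : ℝ} {v : ℝ → EuclideanSpace ℝ (Fin 3) → EuclideanSpace ℝ (Fin 3)}

open Summit.NavierStokesRegularity.NavierStokesRegularity.Theorems.PoloidalWindowDoorPoloidalWindowRigiditySparseEnergyFarFlux

/-! ### The energy identity on every window: cut-off energy and dissipation bounds -/

/-- **CUT-OFF ENERGY AND DISSIPATION OF A CLASS PROFILE (the local energy identity with mean-free fluxes).**  For a profile of the
route's Type-I class there are `A, B ≥ 0` such that for every centre `a`, radius `R > 0` and times `s < t₀ < 0`, with the cut-off
`ψ = cutoff R (a − ·)`:  `∫ ψ|v(t₀)|² ≤ A·R²/√(−t₀) + B·R³/(−t₀)` and `2∫_{s}^{t₀}∫ |Dv|²_F ψ ≤ A·R²/√(−t₀) + B·R³/(−t₀)`.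
(`A = 64V₁C_ΔCC₁`, `B = 32V₁C_∇C(CC₁ + K_p) + 8V₁C²`, `V₁ = |B(0,1)|`.) [folklore] -/
theorem cutoffEnergy_dissipation_le (hrate : HasTypeITimeDecay C v)
    (hcont : ContinuousOn (uncurry v) (Iio (0 : ℝ) ×ˢ univ))
    (hmild : ∀ s t : ℝ, s < t → t < 0 → ∀ x,
      v t x = UnboundedOperators.heatExtension (v s) (t - s) x - oseenDuhamel 1 s v v t x)
    (hdiv : ∀ t < 0, VectorCalculus.IsDivFree (v t)) :
    ∃ A B : ℝ, 0 ≤ A ∧ 0 ≤ B ∧ ∀ (a : EuclideanSpace ℝ (Fin 3)) (R : ℝ), 0 < R → ∀ s t₀ : ℝ, s < t₀ → t₀ < 0 →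
      (∫ x, cutoff R (a - x) * ‖v t₀ x‖ ^ 2) ≤ A * R ^ 2 / Real.sqrt (-t₀) + B * R ^ 3 / (-t₀) ∧
      2 * ∫ t in s..t₀, ∫ x, frobeniusNormSq (fderiv ℝ (v t) x) * cutoff R (a - x) ≤
        A * R ^ 2 / Real.sqrt (-t₀) + B * R ^ 3 / (-t₀) := by
  -- the constants of the class and of the cut-off
  have hC0 : 0 ≤ C := by
    have h := hrate (-1) (by norm_num) 0
    rw [neg_neg, Real.sqrt_one, div_one] at h
    exact (norm_nonneg _).trans h
  obtain ⟨C₁', hC₁'⟩ := exists_fderiv_rate_of_class hrate hcont hmild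
  set C₁ : ℝ := max C₁' 0 with hC₁def
  have hC₁0 : 0 ≤ C₁ := le_max_right _ _
  have hC₁ : ∀ t < 0, ∀ y, ‖fderiv ℝ (v t) y‖ ≤ C₁ / (-t) := fun t ht y =>
    (hC₁' t ht y).trans (div_le_div_of_nonneg_right (le_max_left _ _) (neg_pos.2 ht).le)
  obtain ⟨Kp, hKp0, hKp⟩ := exists_pressureGradient_rate_of_class hrate hcont hmild
  obtain ⟨Cl, hCl0, hCl⟩ := exists_abs_laplacian_cutoff_le (E := EuclideanSpace ℝ (Fin 3))
  obtain ⟨Cg, hCg0, hCg⟩ := exists_norm_fderiv_cutoff_le (E := EuclideanSpace ℝ (Fin 3))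
  set V₁ : ℝ := (volume (ball (0 : EuclideanSpace ℝ (Fin 3)) 1)).toReal with hV₁
  have hV₁0 : 0 ≤ V₁ := ENNReal.toReal_nonneg
  have hmildA := isTypeIAncientMild_of_class hrate hcont hmild hdiv
  set A₀ : ℝ := 32 * V₁ * Cl * C * C₁ with hA₀
  set B₀ : ℝ := 32 * V₁ * Cg * C * (C * C₁ + Kp) with hB₀
  have hA₀0 : 0 ≤ A₀ := by positivity
  have hB₀0 : 0 ≤ B₀ := by positivity
  refine ⟨2 * A₀, B₀ + 8 * V₁ * C ^ 2, by positivity, by positivity, fun a R hR s t₀ hst ht₀ => ?_⟩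
  have hs0 : s < 0 := hst.trans ht₀
  have hns : 0 < -s := neg_pos.2 hs0
  have hnt₀ : 0 < -t₀ := neg_pos.2 ht₀
  set ψ : EuclideanSpace ℝ (Fin 3) → ℝ := fun x => cutoff R (a - x) with hψ
  -- volume of the closed ball of radius `2R`
  have hvol : (volume (closedBall a (2 * R))).toReal = 8 * R ^ 3 * V₁ := by
    rw [Measure.addHaar_closedBall volume a (by positivity : (0 : ℝ) ≤ 2 * R), ENNReal.toReal_mul,
      finrank_euclideanSpace, Fintype.card_fin, ENNReal.toReal_ofReal (by positivity), hV₁]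
    ring
  -- the classical pressure on the window `(s − 1, 0)`
  have hT : s - 1 < 0 := by linarith
  obtain ⟨q, hcl⟩ := hmildA.exists_isClassicalNSSolutionOn_Ioo hT
  -- (1) the slice flux bound on the window
  have hflux : ∀ t ∈ Ioo (s - 1) 0,
      |∫ x, ((Δ ψ) x * ‖v t x‖ ^ 2 + fderiv ℝ ψ x (v t x) * ‖v t x‖ ^ 2 + 2 * (q t x * fderiv ℝ ψ x (v t x)))| ≤
        A₀ * R ^ 2 / ((-t) * Real.sqrt (-t)) + B₀ * R ^ 3 / t ^ 2 := by
    intro t ht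
    have ht0 : t < 0 := ht.2
    have hnt : 0 < -t := neg_pos.2 ht0
    have hsq : 0 < Real.sqrt (-t) := Real.sqrt_pos.2 hnt
    have hu : ContDiff ℝ 1 (v t) := (hcl.smooth_velocity.contDiff_slice ht).of_le (by exact_mod_cast le_top)
    have hp : ContDiff ℝ 1 (q t) := (hcl.smooth_pressure.contDiff_slice ht).of_le (by exact_mod_cast le_top)
    have hdivt : ∀ x, VectorCalculus.divergence (v t) x = 0 := hcl.divFree t ht
    have hDp : ∀ x, ‖fderiv ℝ (q t) x‖ ≤ Kp / ((-t) * Real.sqrt (-t)) := fun x => by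
      have h := hKp (s - 1) q hcl t ht x
      rwa [gradient, LinearIsometryEquiv.norm_map] at h
    have key := abs_flux_le hψ hR hCl hCg hu hdivt hp (M := C / Real.sqrt (-t)) (M₁ := C₁ / (-t))
      (P := Kp / ((-t) * Real.sqrt (-t))) (by positivity) (by positivity) (by positivity)
      (fun x => hrate t ht0 x) (fun x => hC₁ t ht0 x) hDp
    rw [hvol] at key
    refine key.trans (le_of_eq ?_)
    set σ : ℝ := Real.sqrt (-t) with hσ
    have hσt : -t = σ ^ 2 := (Real.sq_sqrt hnt.le).symm
    have hσ0 : 0 < σ := hsq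
    rw [show t ^ 2 = (-t) ^ 2 by ring, hσt, hA₀, hB₀]
    field_simp
    ring
  -- (2) the energy identity on `[s, t₀]`
  have hψC : ContDiff ℝ ((⊤ : ℕ∞) : WithTop ℕ∞) ψ := cutoffT_contDiff hψ
  have hψc : HasCompactSupport ψ := cutoffT_hasCompactSupport hψ hR
  have hI : Icc s t₀ ⊆ Ioo (s - 1) 0 := fun t ht => ⟨by linarith [ht.1], lt_of_le_of_lt ht.2 ht₀⟩
  have hid := hcl.local_energy_identity_cutoff isOpen_Ioo hψC hψc hst.le hI
  simp only [one_mul, mul_one] at hid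
  -- (3) the time integral of the flux
  set Γ : ℝ := 2 * A₀ * R ^ 2 / Real.sqrt (-t₀) + B₀ * R ^ 3 / (-t₀) with hΓ
  have hF : |∫ t in s..t₀, ∫ x, ((Δ ψ) x * ‖v t x‖ ^ 2 + fderiv ℝ ψ x (v t x) * ‖v t x‖ ^ 2 +
      2 * (q t x * fderiv ℝ ψ x (v t x)))| ≤ Γ := by
    rw [← Real.norm_eq_abs]
    refine (intervalIntegral.norm_integral_le_of_norm_le hst.le (Eventually.of_forall fun t ht => ?_)
      ((continuousOn_timeWeight A₀ B₀ R hst.le ht₀).intervalIntegrable)).trans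
      (integral_timeWeight_le hA₀0 hB₀0 hR.le hst.le ht₀)
    rw [Real.norm_eq_abs]
    exact hflux t ⟨by linarith [ht.1], lt_of_le_of_lt ht.2 ht₀⟩
  -- (4) the initial energy at time `s`
  have hEs : ∫ x, ψ x * ‖v s x‖ ^ 2 ≤ 8 * R ^ 3 * V₁ * (C ^ 2 / (-s)) := by
    have hzero : ∀ x, x ∉ closedBall a (2 * R) → ψ x * ‖v s x‖ ^ 2 = 0 := fun x hx => by
      rw [mem_closedBall, not_le] at hx
      rw [cutoffT_eq_zero hψ hR hx.le, zero_mul]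
    rw [← setIntegral_eq_integral_of_forall_compl_eq_zero hzero]
    have hb : ∀ x ∈ closedBall a (2 * R), ‖ψ x * ‖v s x‖ ^ 2‖ ≤ C ^ 2 / (-s) := by
      intro x _
      obtain ⟨h0, h1⟩ := cutoffT_nonneg_le_one hψ x
      rw [Real.norm_eq_abs, abs_of_nonneg (mul_nonneg h0 (sq_nonneg _))]
      have hv : ‖v s x‖ ≤ C / Real.sqrt (-s) := hrate s hs0 x
      have hv2 : ‖v s x‖ ^ 2 ≤ C ^ 2 / (-s) := by
        calc ‖v s x‖ ^ 2 ≤ (C / Real.sqrt (-s)) ^ 2 := pow_le_pow_left₀ (norm_nonneg _) hv 2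
          _ = C ^ 2 / (-s) := by rw [div_pow, Real.sq_sqrt hns.le]
      calc ψ x * ‖v s x‖ ^ 2 ≤ 1 * (C ^ 2 / (-s)) := mul_le_mul h1 hv2 (sq_nonneg _) zero_le_one
        _ = C ^ 2 / (-s) := one_mul _
    have h := norm_setIntegral_le_of_norm_le_const (measure_closedBall_lt_top : volume (closedBall a (2 * R)) < ∞) hb
    rw [measureReal_def, hvol, Real.norm_eq_abs] at h
    linarith [le_abs_self (∫ x in closedBall a (2 * R), ψ x * ‖v s x‖ ^ 2)]
  have hEs' : 8 * R ^ 3 * V₁ * (C ^ 2 / (-s)) ≤ 8 * V₁ * C ^ 2 * R ^ 3 / (-t₀) := by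
    have h1 : C ^ 2 / (-s) ≤ C ^ 2 / (-t₀) := div_le_div_of_nonneg_left (sq_nonneg C) hnt₀ (by linarith)
    have h2 : 8 * R ^ 3 * V₁ * (C ^ 2 / (-t₀)) = 8 * V₁ * C ^ 2 * R ^ 3 / (-t₀) := by ring
    rw [← h2]
    exact mul_le_mul_of_nonneg_left h1 (by positivity)
  -- (5) signs: the dissipation and the final energy are nonnegative
  have hD0 : 0 ≤ ∫ t in s..t₀, ∫ x, frobeniusNormSq (fderiv ℝ (v t) x) * ψ x :=
    intervalIntegral.integral_nonneg hst.le fun t _ =>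
      integral_nonneg fun x => mul_nonneg (frobeniusNormSq_nonneg _) (cutoffT_nonneg_le_one hψ x).1
  have hE0 : 0 ≤ ∫ x, ψ x * ‖v t₀ x‖ ^ 2 :=
    integral_nonneg fun x => mul_nonneg (cutoffT_nonneg_le_one hψ x).1 (sq_nonneg _)
  -- (6) conclude
  have habs := le_abs_self (∫ t in s..t₀, ∫ x, ((Δ ψ) x * ‖v t x‖ ^ 2 + fderiv ℝ ψ x (v t x) * ‖v t x‖ ^ 2 +
      2 * (q t x * fderiv ℝ ψ x (v t x))))
  have hsum : Γ + 8 * V₁ * C ^ 2 * R ^ 3 / (-t₀) = 2 * A₀ * R ^ 2 / Real.sqrt (-t₀) + (B₀ + 8 * V₁ * C ^ 2) * R ^ 3 / (-t₀) := by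
    rw [hΓ]; ring
  constructor
  · show ∫ x, ψ x * ‖v t₀ x‖ ^ 2 ≤ _
    rw [← hsum]; linarith
  · show 2 * ∫ t in s..t₀, ∫ x, frobeniusNormSq (fderiv ℝ (v t) x) * ψ x ≤ _
    rw [← hsum]; linarith

/-! ### Ball forms and the far-from-the-apex half of S1 -/

/-- **BALL ENERGY OF A CLASS PROFILE AT EVERY SCALE AND TIME**: `∫_{B(a,R)} |v(t₀)|² ≤ A·R²/√(−t₀) + B·R³/(−t₀)`
(Bochner and `∫⁻ … ENNReal.ofReal` forms). [folklore] -/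
theorem ballEnergy_le (hrate : HasTypeITimeDecay C v)
    (hcont : ContinuousOn (uncurry v) (Iio (0 : ℝ) ×ˢ univ))
    (hmild : ∀ s t : ℝ, s < t → t < 0 → ∀ x,
      v t x = UnboundedOperators.heatExtension (v s) (t - s) x - oseenDuhamel 1 s v v t x)
    (hdiv : ∀ t < 0, VectorCalculus.IsDivFree (v t)) :
    ∃ A B : ℝ, 0 ≤ A ∧ 0 ≤ B ∧ ∀ (a : EuclideanSpace ℝ (Fin 3)) (R : ℝ), 0 < R → ∀ t₀ : ℝ, t₀ < 0 →
      (∫ x in ball a R, ‖v t₀ x‖ ^ 2) ≤ A * R ^ 2 / Real.sqrt (-t₀) + B * R ^ 3 / (-t₀) ∧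
      (∫⁻ x in ball a R, ENNReal.ofReal (‖v t₀ x‖ ^ 2)) ≤
        ENNReal.ofReal (A * R ^ 2 / Real.sqrt (-t₀) + B * R ^ 3 / (-t₀)) := by
  obtain ⟨A, B, hA, hB, h⟩ := cutoffEnergy_dissipation_le hrate hcont hmild hdiv
  refine ⟨A, B, hA, hB, fun a R hR t₀ ht₀ => ?_⟩
  obtain ⟨hE, -⟩ := h a R hR (t₀ - 1) t₀ (by linarith) ht₀
  set ψ : EuclideanSpace ℝ (Fin 3) → ℝ := fun x => cutoff R (a - x) with hψ
  have hvc : Continuous (v t₀) := LocalSineTubeDoorProfileAlignedWindowRigidityAncient.continuous_slice hcont ht₀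
  have hv2 : Continuous fun x => ‖v t₀ x‖ ^ 2 := (hvc.norm).pow 2
  -- the ball integral is dominated by the cut-off integral
  have hψc : HasCompactSupport ψ := cutoffT_hasCompactSupport hψ hR
  have hfi : Integrable fun x => ψ x * ‖v t₀ x‖ ^ 2 :=
    ((cutoffT_contDiff hψ (n := 0)).continuous.mul hv2).integrable_of_hasCompactSupport hψc.mul_right
  have hball : ∫ x in ball a R, ‖v t₀ x‖ ^ 2 = ∫ x in ball a R, ψ x * ‖v t₀ x‖ ^ 2 := by
    refine setIntegral_congr_fun measurableSet_ball fun x hx => ?_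
    rw [cutoffT_eq_one hψ hR (le_of_lt (mem_ball.1 hx)), one_mul]
  have hle : ∫ x in ball a R, ‖v t₀ x‖ ^ 2 ≤ ∫ x, ψ x * ‖v t₀ x‖ ^ 2 := by
    rw [hball]
    exact setIntegral_le_integral hfi (Eventually.of_forall fun x => mul_nonneg (cutoffT_nonneg_le_one hψ x).1 (sq_nonneg _))
  have h1 : ∫ x in ball a R, ‖v t₀ x‖ ^ 2 ≤ A * R ^ 2 / Real.sqrt (-t₀) + B * R ^ 3 / (-t₀) := hle.trans hE
  refine ⟨h1, ?_⟩
  have hint : IntegrableOn (fun x => ‖v t₀ x‖ ^ 2) (ball a R) :=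
    (hv2.continuousOn.integrableOn_compact (isCompact_closedBall a R)).mono_set ball_subset_closedBall
  rw [← ofReal_integral_eq_lintegral_ofReal hint (ae_of_all _ fun x => sq_nonneg _)]
  exact ENNReal.ofReal_le_ofReal h1

/-- **THE FAR-FROM-THE-APEX HALF OF S1 (`stub_scaledEnergy`)**: there is `K ≥ 0` (depending on the profile through `C, C₁, K_p` only)
such that for every centre `a`, radius `R > 0` and time `t₀ ≤ −R²`:  `∫_{B(a,R)} |v(t₀)|² ≤ K·R`, in both currencies
(the `∫⁻ … ENNReal.ofReal` form is the first conjunct of S1's conclusion verbatim, on the region `−t₀ ≥ R²`). [folklore] -/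
theorem ballEnergy_le_far (hrate : HasTypeITimeDecay C v)
    (hcont : ContinuousOn (uncurry v) (Iio (0 : ℝ) ×ˢ univ))
    (hmild : ∀ s t : ℝ, s < t → t < 0 → ∀ x,
      v t x = UnboundedOperators.heatExtension (v s) (t - s) x - oseenDuhamel 1 s v v t x)
    (hdiv : ∀ t < 0, VectorCalculus.IsDivFree (v t)) :
    ∃ K : ℝ, 0 ≤ K ∧ ∀ (a : EuclideanSpace ℝ (Fin 3)) (R : ℝ), 0 < R → ∀ t₀ : ℝ, t₀ ≤ -R ^ 2 →
      (∫ x in ball a R, ‖v t₀ x‖ ^ 2) ≤ K * R ∧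
      (∫⁻ x in ball a R, ENNReal.ofReal (‖v t₀ x‖ ^ 2)) ≤ ENNReal.ofReal (K * R) := by
  obtain ⟨A, B, hA, hB, h⟩ := ballEnergy_le hrate hcont hmild hdiv
  refine ⟨A + B, by positivity, fun a R hR t₀ ht₀ => ?_⟩
  have hR2 : 0 < R ^ 2 := by positivity
  have ht₀' : t₀ < 0 := by linarith
  have hnt : R ^ 2 ≤ -t₀ := by linarith
  obtain ⟨h1, -⟩ := h a R hR t₀ ht₀'
  -- `R²/√(−t₀) ≤ R` and `R³/(−t₀) ≤ R`
  have hsq : R ≤ Real.sqrt (-t₀) := by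
    rw [← Real.sqrt_sq hR.le]; exact Real.sqrt_le_sqrt hnt
  have e1 : A * R ^ 2 / Real.sqrt (-t₀) ≤ A * R := by
    rw [div_le_iff₀ (lt_of_lt_of_le hR hsq)]
    calc A * R ^ 2 = A * R * R := by ring
      _ ≤ A * R * Real.sqrt (-t₀) := mul_le_mul_of_nonneg_left hsq (by positivity)
  have e2 : B * R ^ 3 / (-t₀) ≤ B * R := by
    rw [div_le_iff₀ (by linarith)]
    calc B * R ^ 3 = B * R * R ^ 2 := by ring
      _ ≤ B * R * (-t₀) := mul_le_mul_of_nonneg_left hnt (by positivity)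
  have hK : ∫ x in ball a R, ‖v t₀ x‖ ^ 2 ≤ (A + B) * R := by linarith
  refine ⟨hK, ?_⟩
  have hv2 : Continuous fun x => ‖v t₀ x‖ ^ 2 := ((LocalSineTubeDoorProfileAlignedWindowRigidityAncient.continuous_slice hcont ht₀').norm).pow 2
  have hint : IntegrableOn (fun x => ‖v t₀ x‖ ^ 2) (ball a R) :=
    (hv2.continuousOn.integrableOn_compact (isCompact_closedBall a R)).mono_set ball_subset_closedBall
  rw [← ofReal_integral_eq_lintegral_ofReal hint (ae_of_all _ fun x => sq_nonneg _)]
  exact ENNReal.ofReal_le_ofReal hK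

/-- **CUT-OFF DISSIPATION, FAR FROM THE APEX**: with the same kind of constant, for `t₀ ≤ −R²` and every `s < t₀`,
`2∫_{s}^{t₀}∫ |Dv|²_F · cutoff R (a − ·) ≤ K·R` (the Frobenius weight dominates `‖Dv‖²` and the cut-off dominates the indicator
of `B(a,R)`, so this bounds the second conjunct of S1's conclusion on every finite past window, uniformly in `s`). [folklore] -/
theorem cutoffDissipation_le_far (hrate : HasTypeITimeDecay C v)
    (hcont : ContinuousOn (uncurry v) (Iio (0 : ℝ) ×ˢ univ))
    (hmild : ∀ s t : ℝ, s < t → t < 0 → ∀ x,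
      v t x = UnboundedOperators.heatExtension (v s) (t - s) x - oseenDuhamel 1 s v v t x)
    (hdiv : ∀ t < 0, VectorCalculus.IsDivFree (v t)) :
    ∃ K : ℝ, 0 ≤ K ∧ ∀ (a : EuclideanSpace ℝ (Fin 3)) (R : ℝ), 0 < R → ∀ s t₀ : ℝ, s < t₀ → t₀ ≤ -R ^ 2 →
      2 * ∫ t in s..t₀, ∫ x, frobeniusNormSq (fderiv ℝ (v t) x) * cutoff R (a - x) ≤ K * R := by
  obtain ⟨A, B, hA, hB, h⟩ := cutoffEnergy_dissipation_le hrate hcont hmild hdiv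
  refine ⟨A + B, by positivity, fun a R hR s t₀ hst ht₀ => ?_⟩
  have hR2 : 0 < R ^ 2 := by positivity
  have ht₀' : t₀ < 0 := by linarith
  have hnt : R ^ 2 ≤ -t₀ := by linarith
  obtain ⟨-, h2⟩ := h a R hR s t₀ hst ht₀'
  have hsq : R ≤ Real.sqrt (-t₀) := by
    rw [← Real.sqrt_sq hR.le]; exact Real.sqrt_le_sqrt hnt
  have e1 : A * R ^ 2 / Real.sqrt (-t₀) ≤ A * R := by
    rw [div_le_iff₀ (lt_of_lt_of_le hR hsq)]
    calc A * R ^ 2 = A * R * R := by ring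
      _ ≤ A * R * Real.sqrt (-t₀) := mul_le_mul_of_nonneg_left hsq (by positivity)
  have e2 : B * R ^ 3 / (-t₀) ≤ B * R := by
    rw [div_le_iff₀ (by linarith)]
    calc B * R ^ 3 = B * R * R ^ 2 := by ring
      _ ≤ B * R * (-t₀) := mul_le_mul_of_nonneg_left hnt (by positivity)
  linarith

/-- **BALL DISSIPATION, FAR FROM THE APEX — the second conjunct of S1 on `−t₀ ≥ R²`**: for `t₀ ≤ −R²`,
`∫⁻_{t<t₀} ∫⁻_{B(a,R)} ‖Dv(t)‖² ≤ K·R` (`‖Dv‖² ≤ |Dv|²_F`, `𝟙_{B(a,R)} ≤ ψ`, continuity of the cut-off dissipation in time on every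
window, and exhaustion of `(−∞, t₀)` by the windows `(t₀ − n − 1, t₀)`). [folklore] -/
theorem ballDissipation_le_far (hrate : HasTypeITimeDecay C v)
    (hcont : ContinuousOn (uncurry v) (Iio (0 : ℝ) ×ˢ univ))
    (hmild : ∀ s t : ℝ, s < t → t < 0 → ∀ x,
      v t x = UnboundedOperators.heatExtension (v s) (t - s) x - oseenDuhamel 1 s v v t x)
    (hdiv : ∀ t < 0, VectorCalculus.IsDivFree (v t)) :
    ∃ K : ℝ, 0 ≤ K ∧ ∀ (a : EuclideanSpace ℝ (Fin 3)) (R : ℝ), 0 < R → ∀ t₀ : ℝ, t₀ ≤ -R ^ 2 →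
      (∫⁻ t in Iio t₀, ∫⁻ x in ball a R, ENNReal.ofReal (‖fderiv ℝ (v t) x‖ ^ 2)) ≤ ENNReal.ofReal (K * R) := by
  obtain ⟨K, hK0, hK⟩ := cutoffDissipation_le_far hrate hcont hmild hdiv
  refine ⟨K, hK0, fun a R hR t₀ ht₀ => ?_⟩
  have hR2 : 0 < R ^ 2 := by positivity
  have ht₀' : t₀ < 0 := by linarith
  set ψ : EuclideanSpace ℝ (Fin 3) → ℝ := fun x => cutoff R (a - x) with hψ
  have hψ0 : Continuous ψ := (cutoffT_contDiff hψ (n := 0)).continuous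
  have hψc : HasCompactSupport ψ := cutoffT_hasCompactSupport hψ hR
  have hmildA := isTypeIAncientMild_of_class hrate hcont hmild hdiv
  have hFnn : ∀ t x, 0 ≤ frobeniusNormSq (fderiv ℝ (v t) x) * ψ x := fun t x =>
    mul_nonneg (frobeniusNormSq_nonneg _) (cutoffT_nonneg_le_one hψ x).1
  have hInn : ∀ t, 0 ≤ ∫ x, frobeniusNormSq (fderiv ℝ (v t) x) * ψ x := fun t => integral_nonneg (hFnn t)
  -- (1) every finite window
  have hwin : ∀ n : ℕ, (∫⁻ t in Ioo (t₀ - (n + 1)) t₀, ∫⁻ x in ball a R, ENNReal.ofReal (‖fderiv ℝ (v t) x‖ ^ 2)) ≤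
      ENNReal.ofReal (K * R) := by
    intro n
    set s : ℝ := t₀ - (n + 1) with hs
    have hst : s < t₀ := by have : (0 : ℝ) ≤ n := n.cast_nonneg; rw [hs]; linarith
    have hT : s - 1 < 0 := by linarith
    obtain ⟨q, hcl⟩ := hmildA.exists_isClassicalNSSolutionOn_Ioo hT
    have hDc : ContinuousOn (fun t => ∫ x, frobeniusNormSq (fderiv ℝ (v t) x) * ψ x) (Ioo (s - 1) 0) :=
      hcl.continuousOn_integral_dissipation_cutoff isOpen_Ioo hψ0 hψc
    -- slice comparison
    have hslice : ∀ t ∈ Ioo s t₀, (∫⁻ x in ball a R, ENNReal.ofReal (‖fderiv ℝ (v t) x‖ ^ 2)) ≤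
        ENNReal.ofReal (∫ x, frobeniusNormSq (fderiv ℝ (v t) x) * ψ x) := by
      intro t ht
      have htS : t ∈ Ioo (s - 1) 0 := ⟨by linarith [ht.1], ht.2.trans ht₀'⟩
      have hu : ContDiff ℝ 1 (v t) := (hcl.smooth_velocity.contDiff_slice htS).of_le (by exact_mod_cast le_top)
      have hFc : Continuous fun x => frobeniusNormSq (fderiv ℝ (v t) x) * ψ x :=
        (LerayHopfProofs.continuous_frobeniusNormSq.comp (hu.continuous_fderiv one_ne_zero)).mul hψ0
      have hFi : Integrable fun x => frobeniusNormSq (fderiv ℝ (v t) x) * ψ x :=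
        hFc.integrable_of_hasCompactSupport hψc.mul_left
      rw [ofReal_integral_eq_lintegral_ofReal hFi (ae_of_all _ (hFnn t))]
      calc (∫⁻ x in ball a R, ENNReal.ofReal (‖fderiv ℝ (v t) x‖ ^ 2))
          ≤ ∫⁻ x in ball a R, ENNReal.ofReal (frobeniusNormSq (fderiv ℝ (v t) x) * ψ x) := by
            refine setLIntegral_mono hFc.measurable.ennreal_ofReal fun x hx => ENNReal.ofReal_le_ofReal ?_
            rw [cutoffT_eq_one hψ hR (le_of_lt (mem_ball.1 hx)), mul_one]
            exact SereginSverak2009.opNorm_sq_le_frobeniusNormSq' _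
        _ ≤ ∫⁻ x, ENNReal.ofReal (frobeniusNormSq (fderiv ℝ (v t) x) * ψ x) := setLIntegral_le_lintegral _ _
    have hmono : (∫⁻ t in Ioo s t₀, ∫⁻ x in ball a R, ENNReal.ofReal (‖fderiv ℝ (v t) x‖ ^ 2)) ≤
        ∫⁻ t in Ioo s t₀, ENNReal.ofReal (∫ x, frobeniusNormSq (fderiv ℝ (v t) x) * ψ x) :=
      setLIntegral_mono' measurableSet_Ioo fun t ht => hslice t ht
    refine hmono.trans ?_
    have hIc : ContinuousOn (fun t => ∫ x, frobeniusNormSq (fderiv ℝ (v t) x) * ψ x) (Icc s t₀) :=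
      hDc.mono fun t ht => ⟨by linarith [ht.1], lt_of_le_of_lt ht.2 ht₀'⟩
    have hIi : IntegrableOn (fun t => ∫ x, frobeniusNormSq (fderiv ℝ (v t) x) * ψ x) (Ioo s t₀) :=
      (hIc.integrableOn_compact isCompact_Icc).mono_set Ioo_subset_Icc_self
    rw [← ofReal_integral_eq_lintegral_ofReal hIi (ae_of_all _ fun t => hInn t)]
    refine ENNReal.ofReal_le_ofReal ?_
    have hK' := hK a R hR s t₀ hst ht₀
    rw [intervalIntegral.integral_of_le hst.le, integral_Ioc_eq_integral_Ioo] at hK'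
    have hI0 : 0 ≤ ∫ t in Ioo s t₀, ∫ x, frobeniusNormSq (fderiv ℝ (v t) x) * ψ x :=
      setIntegral_nonneg measurableSet_Ioo fun t _ => hInn t
    linarith
  -- (2) exhaust `(−∞, t₀)` by the windows
  have hU : Iio t₀ = ⋃ n : ℕ, Ioo (t₀ - (n + 1)) t₀ := by
    ext t
    simp only [mem_Iio, mem_iUnion, mem_Ioo]
    constructor
    · intro ht
      obtain ⟨n, hn⟩ := exists_nat_gt (t₀ - t)
      exact ⟨n, by linarith, ht⟩
    · rintro ⟨n, -, h2⟩
      exact h2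
  have hdir : Directed (· ⊆ ·) fun n : ℕ => Ioo (t₀ - (n + 1)) t₀ := by
    refine Monotone.directed_le fun m n hmn => Ioo_subset_Ioo ?_ le_rfl
    have : (m : ℝ) ≤ n := Nat.cast_le.2 hmn
    linarith
  rw [hU, setLIntegral_iUnion_of_directed _ hdir]
  exact iSup_le hwin

/-- **THE FAR-FROM-THE-APEX HALF OF `stub_scaledEnergy` IN ITS OWN CURRENCY**: there is `K ≥ 0` with, for every `t₀ < 0`, every centre
`a` and every radius `R > 0` such that `t₀ ≤ −R²`, BOTH conjuncts of S1's conclusion: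
`∫⁻_{B(a,R)} ‖v(t₀)‖² ≤ K·R` and `∫⁻_{t<t₀} ∫⁻_{B(a,R)} ‖Dv(t)‖² ≤ K·R`.  (S1 itself asks this for ALL `R > 0`; the region `R² > −t₀`
is the near-apex bootstrap, not in this file.) [folklore] -/
theorem scaledEnergy_far (hrate : HasTypeITimeDecay C v)
    (hcont : ContinuousOn (uncurry v) (Iio (0 : ℝ) ×ˢ univ))
    (hmild : ∀ s t : ℝ, s < t → t < 0 → ∀ x,
      v t x = UnboundedOperators.heatExtension (v s) (t - s) x - oseenDuhamel 1 s v v t x)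
    (hdiv : ∀ t < 0, VectorCalculus.IsDivFree (v t)) :
    ∃ K : ℝ, 0 ≤ K ∧ ∀ t₀ : ℝ, t₀ < 0 → ∀ (a : EuclideanSpace ℝ (Fin 3)) (R : ℝ), 0 < R → t₀ ≤ -R ^ 2 →
      (∫⁻ x in Metric.ball a R, ENNReal.ofReal (‖v t₀ x‖ ^ 2)) ≤ ENNReal.ofReal (K * R) ∧
      (∫⁻ t in Set.Iio t₀, ∫⁻ x in Metric.ball a R, ENNReal.ofReal (‖fderiv ℝ (v t) x‖ ^ 2)) ≤ ENNReal.ofReal (K * R) := by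
  obtain ⟨K₁, hK₁0, hK₁⟩ := ballEnergy_le_far hrate hcont hmild hdiv
  obtain ⟨K₂, hK₂0, hK₂⟩ := ballDissipation_le_far hrate hcont hmild hdiv
  refine ⟨max K₁ K₂, le_max_of_le_left hK₁0, fun t₀ _ a R hR ht₀ => ⟨?_, ?_⟩⟩
  · exact ((hK₁ a R hR t₀ ht₀).2).trans (ENNReal.ofReal_le_ofReal (mul_le_mul_of_nonneg_right (le_max_left _ _) hR.le))
  · exact (hK₂ a R hR t₀ ht₀).trans (ENNReal.ofReal_le_ofReal (mul_le_mul_of_nonneg_right (le_max_right _ _) hR.le))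

end Summit.NavierStokesRegularity.NavierStokesRegularity.Theorems.PoloidalWindowDoorPoloidalWindowRigiditySparseEnergyFarField

end
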